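import Mathlib
import Summits.Ventures.HodgeRepro.Faces

/-!
# Tier4/Common/Face — the rank-four face behind (P): four corners, the embedding `s` and its conjugate `s̄`

Blind re-derivation cell `pub-hodge-repro`, Tier 4 (README §9–§10), seat t4-typer-1 (gen 0).  Target tree path
`lean/Summits/Ventures/HodgeRepro/Tier4/Common/Face.lean`.  Imports the landed face vocabulary of the typer lane
(`Summits.Ventures.HodgeRepro.Faces`: `HodgeRepro.IsComplexConj`, `IsCMType`, `place`, `flipAt`, `faceCorners`,
`sumTwo_faceCorners`; `FaceReduce`: `SumTwo`).

THE OBJECT.  (P) (route/TIER3.md §1 item 3) is stated on a rank-four FACE of a Galois CM field `F` with group `G`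
and complex conjugation `c` (ROUTE.md §3.1, erratum F1): a CM type `Φ ⊆ G` flipped at two distinct infinite places
`p, p′` gives the four CORNERS `T_0 = Φ`, `T_1 = Φ̄^{(p)}`, `T_2 = Φ̄^{(p′)}`, `T_3 = Φ^{(p p′)}`
(`HodgeRepro.faceCorners c Φ p p′`), every embedding lying in exactly two of them (`sumTwo_faceCorners`).  The
embedding `s` of the route is the one of the place `p` that lies in `Φ`: it lies in the corners `T_0, T_1` and in
no other, and its conjugate `s̄ = c s` lies in `T_2, T_3` and in no other — this is why `Ω_s = ω_{0,s} ∧ ω_{1,s}` is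
a wedge over the corners `0, 1` and `Ω_{s̄} = ω_{2,s̄} ∧ ω_{3,s̄}` one over the corners `2, 3` (the labelling used by
`Tier4/Common/Geometry.lean`, `Witness.omega`).  `FaceData G` records `(c, Φ, p, p′, s)` with exactly these
defining properties; the membership facts are PROVED here from the landed lemmas.

Nothing here says anything about the status of the Hodge conjecture for CM abelian varieties, which is NOT proved
(HC_CM is NOT proved by anyone in this repository).
-/

set_option autoImplicit false

namespace Summit.Ventures.HodgeRepro.Tier4.Common

open _root_.HodgeRepro Finset
open scoped Pointwise symmDiff

/-- **A rank-four face with its distinguished embedding**: the Galois group `G` of the Galois CM field, its complex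
conjugation `c`, a CM type `Φ`, two distinct places `p, p′` (`p′ ∉ {p, c p}`), and the embedding `s ∈ Φ` of the
place `p`.  The corners are `HodgeRepro.faceCorners c Φ p p′`. -/
structure FaceData (G : Type) [Group G] [DecidableEq G] [Fintype G] where
  /-- complex conjugation, a central involution of `G` -/
  c : G
  /-- `c` is a complex conjugation -/
  hc : IsComplexConj c
  /-- the CM type `Φ` -/
  Φ : Finset G
  /-- `Φ` is a CM type -/
  hΦ : IsCMType c Φ
  /-- the first flipped place -/
  p : G
  /-- the second flipped place -/
  p' : G
  /-- the two places are distinct: `p′ ∉ {p, c p}` -/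
  hp : p' ∉ place c p
  /-- the embedding `s` of the route -/
  s : G
  /-- `s ∈ Φ` -/
  hsΦ : s ∈ Φ
  /-- `s` is one of the two embeddings of the place `p` -/
  hsp : s ∈ place c p

namespace FaceData

variable {G : Type} [Group G] [DecidableEq G] [Fintype G] (D : FaceData G)

/-- The four corners `T_0, T_1, T_2, T_3` of the face. -/
def corners : Fin 4 → Finset G := faceCorners D.c D.Φ D.p D.p'

/-- The conjugate embedding `s̄ = c s`. -/
def sbar : G := D.c * D.s

/-- Every corner is a CM type. -/
theorem isCMType_corners (i : Fin 4) : IsCMType D.c (D.corners i) :=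
  isCMType_faceCorners D.hc D.hΦ D.p D.p' i

/-- Every embedding lies in exactly two corners (`SumTwo`). -/
theorem sumTwo_corners : SumTwo D.corners :=
  sumTwo_faceCorners D.hc D.hΦ D.hp

/-- `s ∉ {p′, c p′}`. -/
theorem s_not_mem_place' : D.s ∉ place D.c D.p' := by
  intro h
  exact Finset.disjoint_left.1 (disjoint_place D.hc D.hp) D.hsp h

/-- `s̄ ∉ {p′, c p′}`. -/
theorem sbar_not_mem_place' : D.sbar ∉ place D.c D.p' := by
  intro h
  have h' : D.s ∈ place D.c D.p' := by
    have := (conj_mem_place_iff D.hc).1 h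
    simpa [sbar] using this
  exact D.s_not_mem_place' h'

/-- `s̄ ∈ {p, c p}`. -/
theorem sbar_mem_place : D.sbar ∈ place D.c D.p := by
  unfold sbar
  exact (conj_mem_place_iff D.hc).2 D.hsp

/-- `s̄ ∉ Φ`. -/
theorem sbar_not_mem_Φ : D.sbar ∉ D.Φ := by
  unfold sbar
  exact (D.hΦ D.s).1 D.hsΦ

/-- `s ∈ T_0`. -/
theorem s_mem_corner0 : D.s ∈ D.corners 0 := D.hsΦ

/-- `s ∈ T_1 = Φ̄^{(p)}`. -/
theorem s_mem_corner1 : D.s ∈ D.corners 1 := by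
  show D.s ∈ flipAt D.c D.p (D.c • D.Φ)
  rw [mem_flipAt, D.hΦ.smul_eq_compl D.hc, Finset.mem_compl]
  exact Or.inr ⟨D.hsp, not_not.2 D.hsΦ⟩

/-- `s ∉ T_2 = Φ̄^{(p′)}`. -/
theorem s_not_mem_corner2 : D.s ∉ D.corners 2 := by
  show D.s ∉ flipAt D.c D.p' (D.c • D.Φ)
  rw [mem_flipAt, D.hΦ.smul_eq_compl D.hc, Finset.mem_compl]
  have h1 := D.hsΦ
  have h2 := D.s_not_mem_place'
  tauto

/-- `s ∉ T_3 = Φ^{(p p′)}`. -/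
theorem s_not_mem_corner3 : D.s ∉ D.corners 3 := by
  show D.s ∉ flipAt D.c D.p' (flipAt D.c D.p D.Φ)
  rw [mem_flipAt, mem_flipAt]
  have h1 := D.hsΦ
  have h2 := D.hsp
  have h3 := D.s_not_mem_place'
  tauto

/-- `s̄ ∉ T_0 = Φ`. -/
theorem sbar_not_mem_corner0 : D.sbar ∉ D.corners 0 := D.sbar_not_mem_Φ

/-- `s̄ ∉ T_1 = Φ̄^{(p)}`. -/
theorem sbar_not_mem_corner1 : D.sbar ∉ D.corners 1 := by
  show D.sbar ∉ flipAt D.c D.p (D.c • D.Φ)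
  rw [mem_flipAt, D.hΦ.smul_eq_compl D.hc, Finset.mem_compl]
  have h1 := D.sbar_mem_place
  have h2 := D.sbar_not_mem_Φ
  tauto

/-- `s̄ ∈ T_2 = Φ̄^{(p′)}`. -/
theorem sbar_mem_corner2 : D.sbar ∈ D.corners 2 := by
  show D.sbar ∈ flipAt D.c D.p' (D.c • D.Φ)
  rw [mem_flipAt, D.hΦ.smul_eq_compl D.hc, Finset.mem_compl]
  exact Or.inl ⟨D.sbar_not_mem_Φ, D.sbar_not_mem_place'⟩

/-- `s̄ ∈ T_3 = Φ^{(p p′)}`. -/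
theorem sbar_mem_corner3 : D.sbar ∈ D.corners 3 := by
  show D.sbar ∈ flipAt D.c D.p' (flipAt D.c D.p D.Φ)
  rw [mem_flipAt, mem_flipAt]
  exact Or.inl ⟨Or.inr ⟨D.sbar_mem_place, D.sbar_not_mem_Φ⟩, D.sbar_not_mem_place'⟩

/-- **The labelling of (P)**: `s` lies exactly in the corners `0, 1` and `s̄` exactly in the corners `2, 3`. -/
theorem corners_of_s :
    (D.s ∈ D.corners 0 ∧ D.s ∈ D.corners 1 ∧ D.s ∉ D.corners 2 ∧ D.s ∉ D.corners 3) ∧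
      (D.sbar ∉ D.corners 0 ∧ D.sbar ∉ D.corners 1 ∧ D.sbar ∈ D.corners 2 ∧ D.sbar ∈ D.corners 3) :=
  ⟨⟨D.s_mem_corner0, D.s_mem_corner1, D.s_not_mem_corner2, D.s_not_mem_corner3⟩,
    ⟨D.sbar_not_mem_corner0, D.sbar_not_mem_corner1, D.sbar_mem_corner2, D.sbar_mem_corner3⟩⟩

/-- The corner `i` contains `s` iff `i ∈ {0, 1}`. -/
theorem s_mem_corner_iff (i : Fin 4) : D.s ∈ D.corners i ↔ i = 0 ∨ i = 1 := by
  fin_cases i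
  · simp [D.s_mem_corner0]
  · simp [D.s_mem_corner1]
  · simp [D.s_not_mem_corner2]
  · simp [D.s_not_mem_corner3]

/-- The corner `i` contains `s̄` iff `i ∈ {2, 3}`. -/
theorem sbar_mem_corner_iff (i : Fin 4) : D.sbar ∈ D.corners i ↔ i = 2 ∨ i = 3 := by
  fin_cases i
  · simp [D.sbar_not_mem_corner0]
  · simp [D.sbar_not_mem_corner1]
  · simp [D.sbar_mem_corner2]
  · simp [D.sbar_mem_corner3]

/-- The four corners are pairwise distinct CM types (`s` separates `{0,1}` from `{2,3}`, `p′` separates `0` from `1`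
and `2` from `3`). -/
theorem corners_injective : Function.Injective D.corners := by
  intro i j hij
  have hs : ∀ k : Fin 4, D.s ∈ D.corners k ↔ (k = 0 ∨ k = 1) := D.s_mem_corner_iff
  have hne : D.p' ∉ place D.c D.p := D.hp
  have hself : D.p' ∈ place D.c D.p' := mem_place_self D.c D.p'
  have hp' : ∀ k : Fin 4, D.p' ∈ D.corners k ↔ (D.p' ∈ D.Φ ↔ (k = 0 ∨ k = 2)) := by
    intro k
    fin_cases k
    · show D.p' ∈ D.Φ ↔ (D.p' ∈ D.Φ ↔ ((0 : Fin 4) = 0 ∨ (0 : Fin 4) = 2))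
      simp
    · show D.p' ∈ flipAt D.c D.p (D.c • D.Φ) ↔ (D.p' ∈ D.Φ ↔ ((1 : Fin 4) = 0 ∨ (1 : Fin 4) = 2))
      rw [mem_flipAt, D.hΦ.smul_eq_compl D.hc, Finset.mem_compl]
      simp only [Fin.reduceEq, or_self, iff_false]
      tauto
    · show D.p' ∈ flipAt D.c D.p' (D.c • D.Φ) ↔ (D.p' ∈ D.Φ ↔ ((2 : Fin 4) = 0 ∨ (2 : Fin 4) = 2))
      rw [mem_flipAt, D.hΦ.smul_eq_compl D.hc, Finset.mem_compl]
      simp only [Fin.reduceEq, or_true, iff_true]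
      tauto
    · show D.p' ∈ flipAt D.c D.p' (flipAt D.c D.p D.Φ) ↔ (D.p' ∈ D.Φ ↔ ((3 : Fin 4) = 0 ∨ (3 : Fin 4) = 2))
      rw [mem_flipAt, mem_flipAt]
      simp only [Fin.reduceEq, or_self, iff_false]
      tauto
  have h1 : D.s ∈ D.corners i ↔ D.s ∈ D.corners j := by rw [hij]
  have h2 : D.p' ∈ D.corners i ↔ D.p' ∈ D.corners j := by rw [hij]
  rw [hs i, hs j] at h1
  rw [hp' i, hp' j] at h2
  fin_cases i <;> fin_cases j <;> simp at h1 h2 ⊢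

end FaceData

end Summit.Ventures.HodgeRepro.Tier4.Common
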